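import Literature.NumberTheory.Sieve.MoebiusShiftedPrimesArcsProofs
import Literature.NumberTheory.LFunctions.VinogradovZetaSumEstimate
import HarnessLib

/-!
# Möbius on shifted primes — Theorem 2.2 of Lichtman 2020 (the key Fourier estimate), discharged

Topic `Literature/NumberTheory/Sieve`; leaf companion of `MoebiusShiftedPrimesProofs.lean`, whose named fact
`Literature.NumberTheory.Sieve.Lichtman2020_keyFourierEstimate` vendors **Theorem 2.2** of J. D. Lichtman,
*Averages of the Möbius function on shifted primes*, Q. J. Math. 73 (2022) 729–757, doi:10.1093/qmath/haab054 =
arXiv:2009.08969v2 [Lichtman2020] (held copy `paper:arxiv-2009.08969`, Theorem 2.2 on PDF p. 7): "Given any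
`A > 5`, `δ > 0`, let `S = S(X, A, δ)` as in (2.4).  Then if `log H/log₂ X → ∞`,
`sup_α ∫_0^X |∑_{x ≤ n ≤ x+H, n ∈ S} μ(n) e(nα)| dx ≪_{A,δ} HX/(log X)^{A/5}`" (in the regime
`H ≤ exp((log X)^{2/3})` of the printed proof, p. 8, as vendored there).  Everything in this file is PROVED; it
introduces no definition and no named fact.

* `Lichtman2020_keyFourierEstimate_holds` — **THE DISCHARGE of Theorem 2.2 as vendored**, unconditionally.

## The proof (the printed §§3–5, formalised across the tree)

The paper proves Theorem 2.2 from Proposition 2.3 (minor arcs Proposition 3.1 + major arcs Proposition 3.2,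
§3, pp. 9–11), Proposition 3.2 from the mean-square bound Proposition 3.4, and Proposition 3.4 (§5, Proposition
5.1) from Lemma 4.5 — the prime character sum bound that rests on the Vinogradov–Korobov zero-free region for
Dirichlet `L`-functions — together with Lemma 4.8 (Siegel–Walfisz for `λ·χ` on sifted integers).  In the tree:

* Theorem 2.2 ⇐ any Vinogradov–Korobov region `HasVKZeroFreeRegion c T₀`, `c > 0`:
  `Lichtman2020_keyFourierEstimate_of_vk'` (`MoebiusShiftedPrimesArcsProofs.lean`; through
  `Lichtman2020.PrimeCharSum.Lichtman2020_primeCharacterSum_of_vk` = Lemma 4.5, the proved minor arcs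
  `Lichtman2020_minorArcEstimate_holds` = Proposition 3.1, the major arcs by pieces
  `MoebiusShiftedPrimesMajorArcsPieces.lean` = Proposition 3.2, Proposition 5.1 for `S_c`
  `MoebiusShiftedPrimesDirichletMeanValue33.lean`, and Lemma 4.8 `Lichtman2020_liouvilleCharacterSifted_holds`);
  an independent second reduction along the printed set with re-balanced arcs is
  `Lichtman2020_keyFourierEstimate_of_primeCharacterSum_of_liouvilleCharacterSifted`
  (`MoebiusShiftedPrimesRebalanced.lean`);
* the region itself, unconditionally: `VKZeta.exists_hasVKZeroFreeRegion : ∃ c > 0, HasVKZeroFreeRegion c 21`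
  (`Literature/NumberTheory/LFunctions/VinogradovZetaSumEstimate.lean`: Vinogradov's mean value theorem,
  Ivić's Lemmas 6.1–6.3, `VinogradovMeanValue*.lean` ⟹ Ivić's Theorem 6.2 for the shifted zeta sums ⟹
  `VinogradovRangeBound` ⟹ `ExpSumBound` ⟹ Richert-type bounds for `ζ` and `L(s, χ)`
  (`RichertBoundsFromExpSum.lean`) ⟹ the region (`VinogradovKorobovFromRichert.lean`)).

This file only composes the two.

## References

* J. D. Lichtman, *Averages of the Möbius function on shifted primes*, Q. J. Math. 73 (2022), 729–757,
  doi:10.1093/qmath/haab054, arXiv:2009.08969: Theorem 2.2 (p. 7), Proposition 2.3, §§3–5.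
  [cite: Lichtman2020, Theorem 2.2]
* A. Ivić, *The Riemann Zeta-Function*, John Wiley & Sons 1985 (Dover 2003), Ch. 6: Theorem 6.1 (the
  Vinogradov–Korobov zero-free region), Theorem 6.2, Lemma 6.3. [cite: Ivic1985, Theorem 6.1]
-/

noncomputable section

namespace Literature.NumberTheory.Sieve

open Literature.NumberTheory.LFunctions in
/-- **Lichtman 2020, Theorem 2.2 (the key Fourier estimate) — DISCHARGED.**  The named fact
`Lichtman2020_keyFourierEstimate`, exactly as vendored in `MoebiusShiftedPrimesProofs.lean`, holds
unconditionally: the tree's reduction of Theorem 2.2 to a Vinogradov–Korobov zero-free region for Dirichlet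
`L`-functions with any constant (`Lichtman2020_keyFourierEstimate_of_vk'`, the printed §§3–5 with Lemma 4.5
from the region) fed with the tree's unconditional region `VKZeta.exists_hasVKZeroFreeRegion` (Vinogradov's
mean value theorem and Korobov–Vinogradov's zeta-sum estimate, Ivić Ch. 6).
[cite: Lichtman2020, Theorem 2.2] [cite: Ivic1985, Theorem 6.1] -/
theorem Lichtman2020_keyFourierEstimate_holds : Lichtman2020_keyFourierEstimate := by
  obtain ⟨c, hc, hVK⟩ := VKZeta.exists_hasVKZeroFreeRegion
  exact Lichtman2020_keyFourierEstimate_of_vk' hc hVK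

end Literature.NumberTheory.Sieve
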